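import Summits.CriticalPhenomena.PercolationContinuityZ3.Theorems.SahiMasterFamilyTerminalPrelim

/-!
# Face-vanishing triples at a common pivotal coordinate: at most one member is cored

Unit `prim-masterthm-p4` (gen 11; crux anchor stmt-CriticalPhenomena-4575, helper work; memo
`run/shared/lean/prim/prim-masterthm/prim-masterthm-p4/FACE-QUOTIENT-3.md` §4–5).  The open tightness statement
`PositiveSomewhere.FaceVanishingCommonPivotalTight` (to which (P3+) `SahiE3PositiveSomewhere` is reduced) predicts — and the census on
`{0,1}^{≤5}` shows (807/807 coordinates) — that at a common pivotal coordinate `x` of a face-vanishing triple EXACTLY ONE member has `x` in its core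
(`U_j^{x←0} = ∅`).  This file proves the easy half:

* `affects_secAt_true_of_cored` — if `x` lies in the core of the increasing event `A` (`A^{x←0} = ∅`, `A ≠ ∅`) then `x` acts on every contraction
  `A^{y←1}`, `y ≠ x`;
* **`not_both_cored`** — if two members `A, B` of a triple of increasing events determined by `S` both have `x` in their cores, `x` is pivotal for
  the third member `C`, some coordinate `y₀ ≠ x` lies in `S`, and every contraction minor `(A^{y←1}, B^{y←1}, C^{y←1})`, `y ∈ S ∖ {x}`, is a zero flag,
  then `False`.  (Each such minor keeps `x` in `A` and `B`, so its independent pair involves `C^{y←1}`, which is therefore `x`-free; running over the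
  coordinates of a pivotal witness of `C` this forces `{x} ∈ C`, then `C^{y₀←1} = univ`, and `(A'', B'', univ) ∈ Z_3` forces `A'' ⟂ B''` —
  impossible, both contain `x`.)
HONEST FRAMING: the converse half ("at least one cored member") and the tightness statement remain OPEN; (P3+), `C_3`: OPEN. [this work]
-/

noncomputable section

open scoped Classical

namespace Summit.CriticalPhenomena.PercolationContinuityZ3.Theorems

namespace PositiveSomewhere

open Finset Function
open Literature.Probability.Percolation (DeterminedBy determinedBy_iff)
open Literature.Probability.LatticeModels.Kahn2022 (Affects)

variable {ι : Type*} [Fintype ι]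

omit [Fintype ι] in
/-- If `x` lies in the core of the increasing event `A` (`A^{x←0} = ∅`) and `A` is nonempty, then `x` acts on every contraction `A^{y←1}`,
`y ≠ x` (witness: the configuration `univ ∖ {x}`). [this work] -/
theorem affects_secAt_true_of_cored {A : Set (Set ι)} (hA : IsUpperSet A) (hne : A.Nonempty) {x y : ι} (hxy : x ≠ y)
    (hcore : secAt x false A = ∅) : Affects (secAt y true A) x := by
  have hout : Set.univ \ {x} ∉ A := (secAt_false_eq_empty_iff hA x).1 hcore
  have huniv : (Set.univ : Set ι) ∈ A := by
    obtain ⟨ω, hω⟩ := hne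
    exact hA (Set.subset_univ ω) hω
  refine ⟨Set.univ \ {x}, ?_, ?_⟩
  · rw [mem_secAt]
    simp only [forceAt, cond_true]
    have hy : y ∈ Set.univ \ ({x} : Set ι) := ⟨Set.mem_univ y, fun h => hxy (Set.mem_singleton_iff.1 h).symm⟩
    rwa [Set.insert_eq_of_mem hy]
  · rw [mem_secAt]
    simp only [forceAt, cond_true, Set.insert_sdiff_singleton]
    rw [Set.insert_eq_of_mem (Set.mem_univ x), Set.insert_eq_of_mem (Set.mem_univ y)]
    exact huniv

/-- **At most one member of a face-vanishing triple has a given common pivotal coordinate in its core** (ordered form: the two cored members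
first).  Hypotheses: `A, B, C` increasing, determined by `S`; `x` in the cores of `A` and `B` (both nonempty); `x` pivotal for `C`; some
`y₀ ∈ S` with `y₀ ≠ x`; every contraction minor at `y ∈ S ∖ {x}` a zero flag.  Conclusion: `False`. [this work] -/
theorem not_both_cored {A B C : Set (Set ι)} (hA : IsUpperSet A) (hB : IsUpperSet B) (hC : IsUpperSet C)
    (hAne : A.Nonempty) (hBne : B.Nonempty) {S : Finset ι} (hCS : DeterminedBy C (↑S : Set ι)) {x : ι}
    (hcA : secAt x false A = ∅) (hcB : secAt x false B = ∅) (hxC : ∃ ω, x ∉ ω ∧ ω ∉ C ∧ insert x ω ∈ C)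
    (hS : ∃ y ∈ S, y ≠ x)
    (hmin : ∀ y ∈ S, y ≠ x → SuppZeroFlag 3 ![secAt y true A, secAt y true B, secAt y true C]) : False := by
  -- Step 2: every contraction minor at `y ∈ S ∖ {x}` has `C^{y←1}` free of `x`
  have hCfree : ∀ y ∈ S, y ≠ x → ¬ Affects (secAt y true C) x := by
    intro y hyS hyx hCx
    have hup : ∀ j, IsUpperSet ((![secAt y true A, secAt y true B, secAt y true C] : Fin 3 → Set (Set ι)) j) := by
      intro j; fin_cases j
      · exact isUpperSet_secAt y true hA
      · exact isUpperSet_secAt y true hB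
      · exact isUpperSet_secAt y true hC
    obtain ⟨a, b, hab, hd⟩ := exists_disjoint_of_suppZeroFlag_three hup (hmin y hyS hyx)
    have hxa : ∀ j : Fin 3, x ∈ esupp ((![secAt y true A, secAt y true B, secAt y true C] : Fin 3 → Set (Set ι)) j) := by
      intro j; fin_cases j
      · exact mem_esupp.2 (affects_secAt_true_of_cored hA hAne hyx.symm hcA)
      · exact mem_esupp.2 (affects_secAt_true_of_cored hB hBne hyx.symm hcB)
      · exact mem_esupp.2 hCx
    exact Finset.disjoint_left.1 hd (hxa a) (hxa b)
  -- unpacked: `insert x η ∈ C^{y←1} → η ∈ C^{y←1}`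
  have hfree : ∀ y ∈ S, y ≠ x → ∀ η : Set ι, insert y (insert x η) ∈ C → insert y η ∈ C := by
    intro y hyS hyx η h
    have h' : insert x η ∈ secAt y true C := by
      rw [mem_secAt]; simpa only [forceAt, cond_true] using h
    by_contra hη
    have hη' : η ∉ secAt y true C := by
      rw [mem_secAt]; simpa only [forceAt, cond_true] using hη
    exact hCfree y hyS hyx ⟨η, hη', h'⟩
  -- `x ∈ S`
  have hxS : x ∈ S := esupp_subset_of_determinedBy hCS (mem_esupp.2 (by
    obtain ⟨ω, -, hω, hωx⟩ := hxC; exact ⟨ω, hω, hωx⟩))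
  -- Step 3: a pivotal witness for `C` inside `S`, then it must be empty
  obtain ⟨ω₀, hxω₀, hω₀, hω₀x⟩ := hxC
  set ω₁ : Set ι := ω₀ ∩ ↑S with hω₁
  have hxω₁ : x ∉ ω₁ := fun h => hxω₀ h.1
  have hω₁C : ω₁ ∉ C := by
    intro h
    apply hω₀
    rw [determinedBy_iff] at hCS
    refine (hCS ω₀ ω₁ ?_).2 h
    rw [hω₁, Set.inter_assoc, Set.inter_self]
  have hxS' : x ∈ (↑S : Set ι) := by exact_mod_cast hxS
  have hω₁x : insert x ω₁ ∈ C := by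
    rw [determinedBy_iff] at hCS
    refine (hCS (insert x ω₀) (insert x ω₁) ?_).1 hω₀x
    rw [hω₁]
    ext e
    simp only [Set.mem_inter_iff, Set.mem_insert_iff]
    constructor
    · rintro ⟨h | h, he⟩
      · exact ⟨Or.inl h, he⟩
      · exact ⟨Or.inr ⟨h, he⟩, he⟩
    · rintro ⟨h | h, he⟩
      · exact ⟨Or.inl h, he⟩
      · exact ⟨Or.inr h.1, he⟩
  have hω₁e : ω₁ = ∅ := by
    by_contra hne
    obtain ⟨y, hy⟩ := Set.nonempty_iff_ne_empty.2 hne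
    have hyS : y ∈ S := by exact_mod_cast hy.2
    have hyx : y ≠ x := fun h => hxω₁ (h ▸ hy)
    have h1 : insert y (insert x (ω₁ \ {y})) ∈ C := by
      have : insert y (insert x (ω₁ \ {y})) = insert x ω₁ := by
        rw [Set.insert_comm, Set.insert_sdiff_singleton, Set.insert_eq_of_mem hy]
      rw [this]; exact hω₁x
    have h2 := hfree y hyS hyx (ω₁ \ {y}) h1
    rw [Set.insert_sdiff_singleton, Set.insert_eq_of_mem hy] at h2
    exact hω₁C h2
  -- so `{x} ∈ C`
  have hxC' : insert x (∅ : Set ι) ∈ C := by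
    have := hω₁x; rw [hω₁e] at this; exact this
  -- Step 4: at `y₀`, `C^{y₀←1} = univ`
  obtain ⟨y₀, hy₀S, hy₀x⟩ := hS
  have hCuniv : secAt y₀ true C = Set.univ := by
    have h1 : insert y₀ (insert x (∅ : Set ι)) ∈ C := hC (Set.subset_insert y₀ _) hxC'
    have h2 : insert y₀ (∅ : Set ι) ∈ C := hfree y₀ hy₀S hy₀x ∅ h1
    have h3 : (∅ : Set ι) ∈ secAt y₀ true C := by
      rw [mem_secAt]; simpa only [forceAt, cond_true] using h2
    exact Set.eq_univ_of_forall fun ω => (isUpperSet_secAt y₀ true hC) (Set.empty_subset ω) h3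
  -- Step 5: `(A'', B'', univ) ∈ Z_3` forces `A'' ⟂ B''`, but both contain `x`
  have hA'' := isUpperSet_secAt y₀ true hA
  have hB'' := isUpperSet_secAt y₀ true hB
  have hZ := hmin y₀ hy₀S hy₀x
  rw [hCuniv] at hZ
  have hZ' : SuppZeroFlag 3 ![Set.univ, secAt y₀ true A, secAt y₀ true B] :=
    (suppZeroFlag_three_swap12 hA'' isUpperSet_univ hB'').1 ((suppZeroFlag_three_swap23 hA'' hB'' isUpperSet_univ).1 hZ)
  have hd := disjoint_of_suppZeroFlag_three_univ hA'' hB'' hZ'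
  exact Finset.disjoint_left.1 hd (mem_esupp.2 (affects_secAt_true_of_cored hA hAne hy₀x.symm hcA))
    (mem_esupp.2 (affects_secAt_true_of_cored hB hBne hy₀x.symm hcB))

end PositiveSomewhere

end Summit.CriticalPhenomena.PercolationContinuityZ3.Theorems
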